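import Literature.AlgebraicGeometry.Frobenioids.DivisorMonoidCategoryTheoreticityCorProofs
import HarnessLib

/-!
# Frobenioids I, Theorem 3.4 (iv) / Corollary 4.11 (i) — functoriality of the unit-trivialisation
# `C^un-tr`: a unit-preserving equivalence `C₁^istr ⥲ C₂^istr` induces a `1`-unique `Ψ^un-tr`

Mochizuki, *The geometry of Frobenioids I: the general theory*, Kyushu J. Math. **62** (2008)
293–400, kurims text proof of Thm. 3.4 (iv) p. 68 ("since `Ψ` preserves '`O^×(-)`', the existence and
1-uniqueness of a 1-commutative diagram as in the statement … follow immediately from the definition of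
`C_i^un-tr`") and proof of Cor. 4.11 (i) pp. 92–93 ("it suffices to show that `Ψ` preserves '`O^×(-)`'
[cf. the proof of Theorem 3.4, (iv)]") [cite: MochizukiFrdI2008, Cor. 4.11 (i) p.92].

PROOF-ONLY companion of `BaseCategoryTheoreticityDefs.lean` / `DivisorMonoidCategoryTheoreticity.lean`
(seat abc-iut-L1-t3: `S.Untr := Quotient S.UnitEquiv`, `S.toUntr`, the typed `Thm34iv_untr`, `Cor411i`),
generic over `S_i : PreFrobenioidData C_i D_i`:

* `unitEquiv_map_of_units`: a functor `G : C₁^istr ⥤ C₂^istr` mapping `O^×(X)` into `O^×(G X)` preserves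
  unit-equivalence `≈^{O^×}`;
* `exists_untr_oneUniqueSquare`: an equivalence `G : C₁^istr ⥲ C₂^istr` such that `G` and `G⁻¹` preserve
  `≈^{O^×}` induces `G^un-tr : C₁^un-tr ⥤ C₂^un-tr` `1`-commuting with the projections, an equivalence, and
  `1`-unique — the typed `OneUniqueSquare G C₁^istr→C₁^un-tr C₂^istr→C₂^un-tr G^un-tr` (quotient-category
  universal property);
* `cor411i_of_units` / `thm34iv_untr_of_units`: hence the square parts of the typed Cor. 4.11 (i) and
  Thm. 3.4 (iv) follow from "`Ψ^istr`, `(Ψ^istr)⁻¹` preserve `O^×(-)`" — the printed reduction; the rigidity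
  conjuncts are separate inputs (Cor. 4.11 (i): the Div-slimness argument of p. 93);
* `cor411i_of_thm34iv_untr_of_isOfGroupLikeType`: the group-like case of Cor. 4.11 (i) from the typed
  Thm. 3.4 (iv) square ("if `C₁, C₂` are of group-like type … assertions (i), (ii) follow from Theorem 3.4,
  (iv), (v)", p. 92), via "Div-slim amounts to slim" (`isSlim_of_isDivSlim_of_isOfGroupLikeType`) and
  slim ⇒ Frobenius-slim.

No statement of the paper is strengthened; nothing here is specific to the abc programme.
-/

namespace Literature.AlgebraicGeometry.Frobenioids

open CategoryTheory Opposite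

universe w w₁ w₂ v v' v₁ v₁' v₂ v₂' u u' u₁ u₁' u₂ u₂'

namespace PreFrobenioidData

section TwoFrobenioids

variable {C₁ : Type u₁} [Category.{v₁} C₁] {D₁ : Type u₁'} [Category.{v₁'} D₁]
variable {C₂ : Type u₂} [Category.{v₂} C₂] {D₂ : Type u₂'} [Category.{v₂'} D₂]
variable (S₁ : PreFrobenioidData.{w₁} C₁ D₁) (S₂ : PreFrobenioidData.{w₂} C₂ D₂)

/-- A functor `G : C₁^istr ⥤ C₂^istr` that maps every unit `δ ∈ O^×(X)` to a unit of `G X` ("`Ψ` preserves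
'`O^×(-)`'") preserves unit-equivalence `≈^{O^×}` of co-objective morphisms (FrdI Def. 3.1 (iv) p. 57,
proof of Thm. 3.4 (iv) p. 68). [cite: MochizukiFrdI2008, Thm. 3.4 (iv) p.68] -/
theorem unitEquiv_map_of_units (G : S₁.Istr ⥤ S₂.Istr)
    (hunits : ∀ (X : S₁.Istr) (δ : Aut X.obj), δ ∈ S₁.unitsSubgroup X.obj →
      ∃ δ' : Aut (G.obj X).obj, δ' ∈ S₂.unitsSubgroup (G.obj X).obj ∧
        G.map (ObjectProperty.homMk δ.hom) = ObjectProperty.homMk δ'.hom)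
    ⦃A B : S₁.Istr⦄ (α₁ α₂ : A ⟶ B) (h : S₁.UnitEquiv α₁ α₂) :
    S₂.UnitEquiv (G.map α₁) (G.map α₂) := by
  obtain ⟨X, γ, β, δ, hδ, rfl, rfl⟩ := h
  obtain ⟨δ', hδ', hG⟩ := hunits X δ hδ
  exact ⟨G.obj X, G.map γ, G.map β, δ', hδ', G.map_comp γ β, by rw [G.map_comp, G.map_comp, hG]⟩

/-- FUNCTORIALITY OF `C^un-tr` (FrdI proof of Thm. 3.4 (iv) p. 68 / Cor. 4.11 (i) p. 92: "the existence and
1-uniqueness of a 1-commutative diagram … follow immediately from the definition of `C_i^un-tr`"): an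
equivalence `G : C₁^istr ⥲ C₂^istr` such that `G` and `G⁻¹` preserve `≈^{O^×}` induces, by the universal
property of the quotient categories `C_i^un-tr`, a functor `G^un-tr : C₁^un-tr ⥤ C₂^un-tr` with
`G^un-tr ∘ (C₁^istr → C₁^un-tr) ≅ (C₂^istr → C₂^un-tr) ∘ G`, which is an equivalence and `1`-unique.
[cite: MochizukiFrdI2008, Thm. 3.4 (iv) p.68] -/
theorem exists_untr_oneUniqueSquare (G : S₁.Istr ≌ S₂.Istr)
    (hG : ∀ ⦃A B : S₁.Istr⦄ (α₁ α₂ : A ⟶ B), S₁.UnitEquiv α₁ α₂ →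
      S₂.UnitEquiv (G.functor.map α₁) (G.functor.map α₂))
    (hG' : ∀ ⦃A B : S₂.Istr⦄ (β₁ β₂ : A ⟶ B), S₂.UnitEquiv β₁ β₂ →
      S₁.UnitEquiv (G.inverse.map β₁) (G.inverse.map β₂)) :
    ∃ Guntr : S₁.Untr ⥤ S₂.Untr, OneUniqueSquare G.functor S₁.toUntr S₂.toUntr Guntr := by
  -- the lifts of `G ⋙ (C₂^istr → C₂^un-tr)` and `G⁻¹ ⋙ (C₁^istr → C₁^un-tr)` to the quotients
  let L : S₁.Untr ⥤ S₂.Untr := CategoryTheory.Quotient.lift S₁.UnitEquiv (G.functor ⋙ S₂.toUntr)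
    fun _ _ f₁ f₂ h => CategoryTheory.Quotient.sound S₂.UnitEquiv (hG f₁ f₂ h)
  let L' : S₂.Untr ⥤ S₁.Untr := CategoryTheory.Quotient.lift S₂.UnitEquiv (G.inverse ⋙ S₁.toUntr)
    fun _ _ f₁ f₂ h => CategoryTheory.Quotient.sound S₁.UnitEquiv (hG' f₁ f₂ h)
  have i₁ : S₁.toUntr ⋙ L ≅ G.functor ⋙ S₂.toUntr := CategoryTheory.Quotient.lift.isLift _ _ _
  have i₂ : S₂.toUntr ⋙ L' ≅ G.inverse ⋙ S₁.toUntr := CategoryTheory.Quotient.lift.isLift _ _ _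
  -- `L ⋙ L' ≅ 𝟭` and `L' ⋙ L ≅ 𝟭`, by `1`-uniqueness of lifts
  have e₁ : S₁.toUntr ⋙ (L ⋙ L') ≅ S₁.toUntr ⋙ 𝟭 S₁.Untr :=
    (Functor.associator _ _ _).symm ≪≫ Functor.isoWhiskerRight i₁ L' ≪≫ Functor.associator _ _ _ ≪≫
      Functor.isoWhiskerLeft G.functor i₂ ≪≫ (Functor.associator _ _ _).symm ≪≫
      Functor.isoWhiskerRight G.unitIso.symm S₁.toUntr ≪≫ Functor.leftUnitor _ ≪≫ (Functor.rightUnitor _).symm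
  have e₂ : S₂.toUntr ⋙ (L' ⋙ L) ≅ S₂.toUntr ⋙ 𝟭 S₂.Untr :=
    (Functor.associator _ _ _).symm ≪≫ Functor.isoWhiskerRight i₂ L ≪≫ Functor.associator _ _ _ ≪≫
      Functor.isoWhiskerLeft G.inverse i₁ ≪≫ (Functor.associator _ _ _).symm ≪≫
      Functor.isoWhiskerRight G.counitIso S₂.toUntr ≪≫ Functor.leftUnitor _ ≪≫ (Functor.rightUnitor _).symm
  have η : 𝟭 S₁.Untr ≅ L ⋙ L' := (CategoryTheory.Quotient.natIsoLift S₁.UnitEquiv e₁).symm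
  have ε : L' ⋙ L ≅ 𝟭 S₂.Untr := CategoryTheory.Quotient.natIsoLift S₂.UnitEquiv e₂
  haveI : L.IsEquivalence := (CategoryTheory.Equivalence.mk L L' η ε).isEquivalence_functor
  refine ⟨L, inferInstance, ⟨i₁.symm⟩, fun B' hB' => ?_⟩
  obtain ⟨ι⟩ := hB'
  exact ⟨CategoryTheory.Quotient.natIsoLift S₁.UnitEquiv (ι.symm ≪≫ i₁.symm)⟩

variable (Ψ : C₁ ≌ C₂)

/-- **Corollary 4.11 (i) REDUCED** to unit preservation (FrdI proof of Cor. 4.11 (i) pp. 92–93: "it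
suffices to show that `Ψ` preserves '`O^×(-)`' [cf. the proof of Theorem 3.4, (iv)]" — shown in print from
Div-slimness, Thm. 3.4 (iii) and Thm. 4.2 (i)): if `Ψ^istr` is an equivalence such that it and its
quasi-inverse preserve `≈^{O^×}`, then the square part of the typed Cor. 4.11 (i) holds, and the whole typed
statement holds given the printed rigidity of the composites (the Div-slimness argument of p. 93, an input
here). [cite: MochizukiFrdI2008, Cor. 4.11 (i) p.91] -/
theorem cor411i_of_units (G : S₁.Istr ≌ S₂.Istr)
    (hG : ∀ ⦃A B : S₁.Istr⦄ (α₁ α₂ : A ⟶ B), S₁.UnitEquiv α₁ α₂ →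
      S₂.UnitEquiv (G.functor.map α₁) (G.functor.map α₂))
    (hG' : ∀ ⦃A B : S₂.Istr⦄ (β₁ β₂ : A ⟶ B), S₂.UnitEquiv β₁ β₂ →
      S₁.UnitEquiv (G.inverse.map β₁) (G.inverse.map β₂))
    (hrig : IsRigidFunctor (G.functor ⋙ S₂.toUntr)) : Cor411i S₁ S₂ Ψ G.functor := by
  intro _
  obtain ⟨L, hL⟩ := exists_untr_oneUniqueSquare S₁ S₂ G hG hG'
  obtain ⟨i⟩ := hL.2.1
  refine ⟨L, hL, hrig, ?_⟩
  -- rigidity is invariant under the isomorphism `G ⋙ toUntr₂ ≅ toUntr₁ ⋙ L`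
  intro α
  have h := hrig (i ≪≫ α ≪≫ i.symm)
  have h' : α = i.symm ≪≫ (i ≪≫ α ≪≫ i.symm) ≪≫ i := by
    ext X
    simp
  rw [h', h]
  ext X
  simp

/-- **Theorem 3.4 (iv), unit-trivialisation square, REDUCED** to unit preservation (FrdI proof of
Thm. 3.4 (iv) p. 68): if `Ψ^istr` is an equivalence such that it and its quasi-inverse preserve `≈^{O^×}`,
and the composites are rigid for slim bases (Prop. 1.13 (i) side), the typed `Thm34iv_untr` holds.
[cite: MochizukiFrdI2008, Thm. 3.4 (iv) p.63] -/
theorem thm34iv_untr_of_units (G : S₁.Istr ≌ S₂.Istr)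
    (hG : ∀ ⦃A B : S₁.Istr⦄ (α₁ α₂ : A ⟶ B), S₁.UnitEquiv α₁ α₂ →
      S₂.UnitEquiv (G.functor.map α₁) (G.functor.map α₂))
    (hG' : ∀ ⦃A B : S₂.Istr⦄ (β₁ β₂ : A ⟶ B), S₂.UnitEquiv β₁ β₂ →
      S₁.UnitEquiv (G.inverse.map β₁) (G.inverse.map β₂))
    (hrig : IsSlim D₁ → IsSlim D₂ → IsRigidFunctor (G.functor ⋙ S₂.toUntr)) :
    Thm34iv_untr S₁ S₂ Ψ G.functor := by
  intro _ _ _ _ _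
  obtain ⟨L, hL⟩ := exists_untr_oneUniqueSquare S₁ S₂ G hG hG'
  obtain ⟨i⟩ := hL.2.1
  refine ⟨L, hL, fun h₁ h₂ => ⟨hrig h₁ h₂, ?_⟩⟩
  intro α
  have h := hrig h₁ h₂ (i ≪≫ α ≪≫ i.symm)
  have h' : α = i.symm ≪≫ (i ≪≫ α ≪≫ i.symm) ≪≫ i := by
    ext X
    simp
  rw [h', h]
  ext X
  simp

/-- **Corollary 4.11 (i), group-like case**, DISCHARGED modulo the typed Thm. 3.4 (iv) square for
`Ψ^istr` ("if `C₁, C₂` are of group-like type … assertions (i), (ii) follow from Theorem 3.4, (iv), (v)",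
FrdI p. 92): Div-slimness of the `D_i` amounts to slimness (`isSlim_of_isDivSlim_of_isOfGroupLikeType`),
slim implies Frobenius-slim, so the typed `Thm34iv_untr` supplies `Ψ^un-tr` together with the rigidity of
the composites. [cite: MochizukiFrdI2008, Cor. 4.11 (i) p.91] -/
theorem cor411i_of_thm34iv_untr_of_isOfGroupLikeType (Ψistr : S₁.Istr ⥤ S₂.Istr)
    (hbase₁ : ∀ X : D₁, ∃ A : C₁, Nonempty (S₁.base.obj A ≅ X))
    (hbase₂ : ∀ X : D₂, ∃ A : C₂, Nonempty (S₂.base.obj A ≅ X))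
    (hgl₁ : S₁.IsOfGroupLikeType) (hgl₂ : S₂.IsOfGroupLikeType) (h34 : Thm34iv_untr S₁ S₂ Ψ Ψistr) :
    Cor411i S₁ S₂ Ψ Ψistr := by
  intro hs
  have hsl₁ : IsSlim D₁ := S₁.isSlim_of_isDivSlim_of_isOfGroupLikeType hbase₁ hgl₁ hs.divSlim.1
  have hsl₂ : IsSlim D₂ := S₂.isSlim_of_isDivSlim_of_isOfGroupLikeType hbase₂ hgl₂ hs.divSlim.2
  obtain ⟨L, hL, hrig⟩ := h34 hs.standard.1 hs.standard.2 hs.hypB hsl₁.isFrobeniusSlim hsl₂.isFrobeniusSlim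
  exact ⟨L, hL, hrig hsl₁ hsl₂⟩

end TwoFrobenioids

end PreFrobenioidData

end Literature.AlgebraicGeometry.Frobenioids
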